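import Literature.NumberTheory.EllipticCurves.BhargavaShankarSelmerTwoAverageHolds
import Literature.NumberTheory.EllipticCurves.BhargavaShankarParametrizationProofs
import Literature.NumberTheory.EllipticCurves.BhargavaShankarSieveStepEquivProofs
import Literature.NumberTheory.EllipticCurves.BhargavaShankarClassCountHolds
import HarnessLib

/-!
# Bhargava–Shankar, Thm 1.1 (`average_card_selmerTwo`): the upper half of display (31) is a
# theorem — only its LOWER half remains (proofs only)

`Proofs`-style file (theorems only: no definitions, no named facts). Librarian fact decomposition
(`fact-decompose`, human 2026-08-16) of the budget-capped named fact
`Literature.NumberTheory.EllipticCurves.average_card_selmerTwo` (bsd.S26; M. Bhargava, A. Shankar,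
*Binary quartic forms having bounded invariants, and the boundedness of the average rank of
elliptic curves*, Ann. of Math. (2) 181 (2015) 191–242 = arXiv:1006.1002, Thm 1.1: the average of
`#Sel^(2)(E/ℚ)` over the curves `E_{A,B}` of naive height `< X` tends to `3`).

State of the tree. Thm 1.1 follows from display (31) of §5.4 (v2 numbering) alone
(`average_card_selmerTwo_of_eq31`: Thm 5.6, Props. 5.7–5.8, Lemmas 5.15–5.16 proved), and (31),
`bhargavaShankar_sum_irredClassCount_asymptotic` — `Σ_{H(E_{A,B}) < X} #{PGL₂(ℚ)-classes of locally
soluble irreducible quartics with the invariants of E_{A,B}} / X^{5/6} → 2 c_F` — is a two-sided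
limit whose **upper half (U31) is a theorem**: `sum_irredClassCount_le_holds` below, i.e.
`BinaryQuartic.sum_irredClassCount_le_of_upperCongruenceCount` (the upper-bound sieve of the proof
of Thm 2.21 with `m = ∏ m_p`, v3 §2.7 and proof of Thm 3.19) fed with the proved upper congruence
count `BinaryQuartic.upperCongruenceCount` (Thm 2.12, upper half, from Thm 2.1) and the proved
local integrals `BinaryQuartic.integral_sievePhi_eq` (Prop. 3.13). Thm 2.1 itself is
`bhargavaShankar_classCount_holds`.

Hence exactly ONE piece of the printed proof is open; it is displayed below as the hypothesis `hL`
(not minted as a named fact: it is the `liminf` half of the existing named fact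
`bhargavaShankar_sum_irredClassCount_asymptotic`):

* **(L31), the lower half of display (31)**: for
  every `ε > 0`, eventually in `X`, `Σ_{H(E_{A,B}) < X} #{classes} ≥ (2 c_F − ε) X^{5/6}`. Its
  printed proof is the `liminf` half of the proof of Thm 2.21 (v3 §2.7: "We now obtain a lower
  bound using Theorem 2.13 …"): the lower half of the weighted congruence count Thm 2.12 with
  levels `ψ_{p,⌊Y/p⌋} ↑ φ_p`, the uniformity estimate Thm 2.13
  (`N(∪_{p>Y} W_p; X) = O(X^{5/6}/log Y) + o(X^{5/6})`, `W_p = {p² ∣ Δ}`; ⇐ Thms 2.14, 2.17–2.20,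
  Prop. 2.16, i.e. Bhargava's geometric sieve), the acceptability of `φ` (Prop. 3.18: `f` bad at
  `p > 2` ⇒ `p² ∣ Δ(f)`; the divisibility half is `BinaryQuartic.sq_dvd_disc_of_twisted_diagonal_integral`),
  the exchange of `lim_Y` with the Euler product ((26)–(27); abstractly PROVED:
  `BhargavaShankar.eventually_tprod_sub_le_prod`, `BhargavaShankar.tendsto_of_sandwich_levels` in
  `BhargavaShankarSieveSkeletonProofs`), and `#classes(S_{A,B}) ≥ Σ_{O ⊂ S_{A,B}} 1/m(f_O)`
  (v3 §3.2, `1/m ≤ 1/n`; equality off rational `2`-torsion is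
  `BinaryQuartic.pgl2QClassCount_selmerSet_eq_sum_one_div_globalWeight`).

and the PROVED theorems

* `sum_irredClassCount_le_holds` — **(U31)**, the upper half of (31), outright;
* `bhargavaShankar_sum_irredClassCount_asymptotic_of_lower : (L31) → (31)` (squeeze with (U31));
* `average_card_selmerTwo_of_lower : (L31) → average_card_selmerTwo`;
* `bhargavaShankar_locSolIrredClassCount_asymptotic_of_lower : (L31) → (†)`, the sieve step
  `bhargavaShankar_locSolIrredClassCount_asymptotic` (equivalent to (31) granted Thm 2.1,
  `bhargavaShankar_locSolIrredClassCount_asymptotic_of_sum_irredClassCount_asymptotic`), so that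
  the three open named facts `average_card_selmerTwo`, `bhargavaShankar_sum_irredClassCount_asymptotic`
  and `bhargavaShankar_locSolIrredClassCount_asymptotic` all close with (L31);
* `average_card_selmerTwo_holds_of : bhargavaShankar_locSolIrredClassCount_asymptotic →
  average_card_selmerTwo` — the parent from its one remaining NAMED input (†), Thm 2.1 being the
  theorem `bhargavaShankar_classCount_holds` (the fact-decomposition record: one existing child).

## References

* M. Bhargava, A. Shankar, Ann. of Math. (2) 181 (2015) 191–242 = arXiv:1006.1002; v2 numbering:
  Thm 1.1, §5.4 display (31), Prop. 5.13; published (v3) numbering: Thms 2.12, 2.13, 2.21 (§2.7),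
  Prop. 3.18, Thm 3.19. [cite: BhargavaShankarAnnals2015, Thm 1.1; §5.4 eq. (31) (arXiv:1006.1002v2 numbering); §2.7 proof of Thm 2.21, lower bound (published numbering)]
-/

noncomputable section

open scoped Classical Topology
open Filter Set MeasureTheory Finset

namespace Literature.NumberTheory.EllipticCurves

open BinaryQuartic

/-! ## The proved upper half (U31) -/

/-- **(U31) — the upper half of display (31), proved**: for every `ε > 0`, eventually in `X`,
`Σ_{H(E_{A,B}) < X} #{classes} ≤ (2c_F + ε)·X^{5/6}` — the upper-bound sieve
`BinaryQuartic.sum_irredClassCount_le_of_upperCongruenceCount` fed with the proved upper congruence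
count (D) `BinaryQuartic.upperCongruenceCount` (Thm 2.12, upper half) and the proved local
integrals (F) `BinaryQuartic.integral_sievePhi_eq` (Prop. 3.13).
[cite: BhargavaShankarAnnals2015, §5.4 eq. (31), upper bound (arXiv:1006.1002v2 numbering) = §2.7 proof of Thm 2.21 (upper bound) and proof of Thm 3.19 (published numbering)] -/
theorem sum_irredClassCount_le_holds :
    ∀ ε : ℝ, 0 < ε → ∀ᶠ X : ℕ in atTop,
      (∑ AB ∈ heightFamilyBelow X,
          (pgl2QClassCount {f : BinaryQuartic ℤ | f.IsLocallySoluble ∧ f.IsIrreducible ∧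
              f.I = 2 ^ 4 * (-3 * AB.1) ∧ f.J = 2 ^ 6 * (-27 * AB.2)} : ℝ)) ≤
        (2 * heightFamilyConstant + ε) * (X : ℝ) ^ (5 / 6 : ℝ) :=
  sum_irredClassCount_le_of_upperCongruenceCount
    (fun N _ Ψ hΨ0 hΨ1 hΨinv ε hε => BinaryQuartic.upperCongruenceCount N Ψ hΨ0 hΨ1 hΨinv ε hε)
    (fun p _ => BinaryQuartic.integral_sievePhi_eq p)

/-! ## The assemblies -/

/-- **Display (31) (`bhargavaShankar_sum_irredClassCount_asymptotic`) from its lower half (L31)**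
(Bhargava–Shankar, arXiv:1006.1002v2 §5.4 = published §3.6 proof of Thm 3.19, first display, read
as a `liminf` inequality: for every `ε > 0`, eventually `(2c_F − ε)X^{5/6} ≤ Σ_{H(E_{A,B})<X} #{classes}`
— its printed proof is the lower bound in the proof of Thm 2.21, §2.7: Thm 2.12 lower half with the
levels `ψ_{p,⌊Y/p⌋}`, the uniformity estimate Thm 2.13, acceptability Prop. 3.18, (26)–(27)), the
upper half (U31) being the theorem `sum_irredClassCount_le_holds`: a sequence squeezed between
`(2c_F − ε)X^{5/6}` and `(2c_F + ε)X^{5/6}` for every `ε > 0` has `Σ/X^{5/6} → 2c_F`.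
[cite: BhargavaShankarAnnals2015, §5.4 eq. (31) (arXiv:1006.1002v2 numbering); §2.7 proof of Thm 2.21, lower bound (published numbering)] -/
theorem bhargavaShankar_sum_irredClassCount_asymptotic_of_lower
    (hL : ∀ ε : ℝ, 0 < ε → ∀ᶠ X : ℕ in atTop,
      (2 * heightFamilyConstant - ε) * (X : ℝ) ^ (5 / 6 : ℝ) ≤
        ∑ AB ∈ heightFamilyBelow X,
          (pgl2QClassCount {f : BinaryQuartic ℤ | f.IsLocallySoluble ∧ f.IsIrreducible ∧
              f.I = 2 ^ 4 * (-3 * AB.1) ∧ f.J = 2 ^ 6 * (-27 * AB.2)} : ℝ)) :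
    bhargavaShankar_sum_irredClassCount_asymptotic := by
  unfold bhargavaShankar_sum_irredClassCount_asymptotic
  set S : ℕ → ℝ := fun X => ∑ AB ∈ heightFamilyBelow X,
      (pgl2QClassCount {f : BinaryQuartic ℤ | f.IsLocallySoluble ∧ f.IsIrreducible ∧
          f.I = 2 ^ 4 * (-3 * AB.1) ∧ f.J = 2 ^ 6 * (-27 * AB.2)} : ℝ) with hS
  set L : ℝ := 2 * heightFamilyConstant with hLdef
  change Tendsto (fun X : ℕ => S X / (X : ℝ) ^ (5 / 6 : ℝ)) atTop (𝓝 L)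
  rw [tendsto_order]
  constructor
  · intro a ha
    have hε : 0 < (L - a) / 2 := by linarith
    filter_upwards [hL _ hε, eventually_gt_atTop 0] with X hX hX0
    have hXpow : 0 < (X : ℝ) ^ (5 / 6 : ℝ) := Real.rpow_pos_of_pos (by exact_mod_cast hX0) _
    rw [lt_div_iff₀ hXpow]
    have h1 : a * (X : ℝ) ^ (5 / 6 : ℝ) < (L - (L - a) / 2) * (X : ℝ) ^ (5 / 6 : ℝ) :=
      mul_lt_mul_of_pos_right (by linarith) hXpow
    exact h1.trans_le hX
  · intro b hb
    have hε : 0 < (b - L) / 2 := by linarith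
    filter_upwards [sum_irredClassCount_le_holds _ hε, eventually_gt_atTop 0] with X hX hX0
    have hXpow : 0 < (X : ℝ) ^ (5 / 6 : ℝ) := Real.rpow_pos_of_pos (by exact_mod_cast hX0) _
    rw [div_lt_iff₀ hXpow]
    have h1 : (L + (b - L) / 2) * (X : ℝ) ^ (5 / 6 : ℝ) < b * (X : ℝ) ^ (5 / 6 : ℝ) :=
      mul_lt_mul_of_pos_right (by linarith) hXpow
    exact lt_of_le_of_lt hX h1

/-- **Bhargava–Shankar, Thm 1.1 (`average_card_selmerTwo`) from the lower half (L31) of display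
(31) alone**: display (31) by the squeeze above, then `average_card_selmerTwo_of_eq31` (Thm 5.6,
Props. 5.7–5.8, Lemmas 5.15–5.16, all proved). [cite: BhargavaShankarAnnals2015, Thm 1.1] -/
theorem average_card_selmerTwo_of_lower
    (hL : ∀ ε : ℝ, 0 < ε → ∀ᶠ X : ℕ in atTop,
      (2 * heightFamilyConstant - ε) * (X : ℝ) ^ (5 / 6 : ℝ) ≤
        ∑ AB ∈ heightFamilyBelow X,
          (pgl2QClassCount {f : BinaryQuartic ℤ | f.IsLocallySoluble ∧ f.IsIrreducible ∧
              f.I = 2 ^ 4 * (-3 * AB.1) ∧ f.J = 2 ^ 6 * (-27 * AB.2)} : ℝ)) :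
    average_card_selmerTwo :=
  average_card_selmerTwo_of_eq31 (bhargavaShankar_sum_irredClassCount_asymptotic_of_lower hL)

/-- **The sieve step (†) `bhargavaShankar_locSolIrredClassCount_asymptotic` from (L31)** — (†) is
equivalent to display (31) granted Thm 2.1
(`bhargavaShankar_locSolIrredClassCount_asymptotic_of_sum_irredClassCount_asymptotic`), and Thm 2.1
is the theorem `bhargavaShankar_classCount_holds`.
[cite: BhargavaShankarAnnals2015, §5.4 eq. (31), second line (arXiv:1006.1002v2 numbering)] -/
theorem bhargavaShankar_locSolIrredClassCount_asymptotic_of_lower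
    (hL : ∀ ε : ℝ, 0 < ε → ∀ᶠ X : ℕ in atTop,
      (2 * heightFamilyConstant - ε) * (X : ℝ) ^ (5 / 6 : ℝ) ≤
        ∑ AB ∈ heightFamilyBelow X,
          (pgl2QClassCount {f : BinaryQuartic ℤ | f.IsLocallySoluble ∧ f.IsIrreducible ∧
              f.I = 2 ^ 4 * (-3 * AB.1) ∧ f.J = 2 ^ 6 * (-27 * AB.2)} : ℝ)) :
    bhargavaShankar_locSolIrredClassCount_asymptotic :=
  bhargavaShankar_locSolIrredClassCount_asymptotic_of_sum_irredClassCount_asymptotic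
    (bhargavaShankar_sum_irredClassCount_asymptotic_of_lower hL) bhargavaShankar_classCount_holds

/-- **The fact-decomposition record for `average_card_selmerTwo`**: the named fact follows from
its one remaining named input, the sieve step (†) `bhargavaShankar_locSolIrredClassCount_asymptotic`
(v2 display (31), lines 1–2 = v3 Thm 2.21 with Props 3.6, 3.9, 3.18), Thm 2.1 being the theorem
`bhargavaShankar_classCount_holds` and everything downstream proved
(`average_card_selmerTwo_of_sieve_of_classCount`). [cite: BhargavaShankarAnnals2015, Thm 1.1; §5.4 eq. (31) (arXiv:1006.1002v2 numbering)] -/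
theorem average_card_selmerTwo_holds_of (hG : bhargavaShankar_locSolIrredClassCount_asymptotic) :
    average_card_selmerTwo :=
  average_card_selmerTwo_of_sieve_of_classCount hG bhargavaShankar_classCount_holds

/-- Conversely (L31) is implied by display (31): a sequence with `Σ/X^{5/6} → 2c_F` is eventually
`≥ (2c_F − ε)X^{5/6}`. [cite: BhargavaShankarAnnals2015, §5.4 eq. (31) (arXiv:1006.1002v2 numbering)] -/
theorem sum_irredClassCount_lower_of_asymptotic
    (h31 : bhargavaShankar_sum_irredClassCount_asymptotic) :
    ∀ ε : ℝ, 0 < ε → ∀ᶠ X : ℕ in atTop,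
      (2 * heightFamilyConstant - ε) * (X : ℝ) ^ (5 / 6 : ℝ) ≤
        ∑ AB ∈ heightFamilyBelow X,
          (pgl2QClassCount {f : BinaryQuartic ℤ | f.IsLocallySoluble ∧ f.IsIrreducible ∧
              f.I = 2 ^ 4 * (-3 * AB.1) ∧ f.J = 2 ^ 6 * (-27 * AB.2)} : ℝ) := by
  intro ε hε
  have h : Tendsto _ atTop (𝓝 (2 * heightFamilyConstant)) := h31
  filter_upwards [h.eventually_const_lt (sub_lt_self _ hε), eventually_gt_atTop 0] with X hX hX0
  have hXpow : 0 < (X : ℝ) ^ (5 / 6 : ℝ) := Real.rpow_pos_of_pos (by exact_mod_cast hX0) _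
  exact ((lt_div_iff₀ hXpow).mp hX).le

end Literature.NumberTheory.EllipticCurves

end
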